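import Summits.Ventures.CertifiedArithmetic.LowPrec.MX
import Mathlib.Data.Fintype.BigOperators

/-!
# GemmEnvelopeDecomposition — the worst-case E-DEC decomposition of one scaled-GEMM output entry (LXX-a)

HONEST FRAMING: certified error envelopes and provably optimal rounding/accumulation schemes for
low-precision formats under stated cost models; every table by two implementations; no hardware or
vendor claims.

The cell's THEOREM-SHAPES §4.1 («E-DEC», idea-2 v5) decomposes the error of one output entry of a
low-precision GEMM `c = post(acc(∑ₖ qaₖ · qbₖ))` into four budget lines:

* operand quantisation: `|qaₖ - aₖ| ≤ ua · |aₖ|`, `|qbₖ - bₖ| ≤ ub · |bₖ|` (per-element RELATIVE atoms —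
  for block / vector scaled formats these are the element atoms in the regime where every element is
  normal after scaling; the atoms themselves are `EnvelopeAtoms.roundNERelSharp` & co.);
* the exact product of two quantised operands (no error);
* accumulation: `|acc - ∑ qaₖ qbₖ| ≤ γ · ∑ |qaₖ qbₖ|` (Higham's `γ`-model, or the kernel's certified
  two-level constants of `AccumulateTwoLevel`);
* output rounding / descaling: `|c - acc| ≤ δ · |acc|`.

With the QUANTISATION CONSTANT `ε_Q := ua + ub + ua · ub` (the worst case of the exact product identity
`qa·qb - a·b = a·β + α·b + α·β`, `α := qa - a`, `β := qb - b`) and `L := ∑ |aₖ bₖ|` the conclusion is the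
functional-F1 envelope

  `|c - ∑ aₖ bₖ| ≤ (ε_Q + γ · (1 + ε_Q) + δ · (1 + ε_Q) · (1 + γ)) · L`.

This file proves it over an arbitrary finite index type (`eDec`), in the cell's verbatim candidate form
L1 `EDecF1` over `Fin K` (`eDecF1`), in the absolute functional-F2 form `≤ (…) · (K · A · B)` under
`|aₖ| ≤ A`, `|bₖ| ≤ B` (`eDec_abs`), and for one quantised operand (`eDec_oneOperand`). Everything is
exact rational algebra: no format, no rounding function and no hardware enters — the scaled-quantiser
instances (MX ceil / floor, per-vector ideal / power-of-two, INT8) are discharged in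
`GemmEnvelopeScaled`. No `sorry`; axioms `propext`, `Classical.choice`, `Quot.sound` only.
-/

namespace Summit.Ventures.CertifiedArithmetic.LowPrec.GemmEnvelope

open Finset

variable {ι : Type*}

/-! ## Termwise algebra -/

/-- A relative perturbation `|qa - a| ≤ ua·|a|` gives `|qa| ≤ (1 + ua)·|a|` (no sign hypothesis on
`ua` is needed: a negative `ua` forces `a = qa = 0`). [cite: Higham2002ASNA, §3.1] -/
theorem abs_le_one_add_mul {a qa ua : ℚ} (ha : |qa - a| ≤ ua * |a|) : |qa| ≤ (1 + ua) * |a| := by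
  calc |qa| = |a + (qa - a)| := by congr 1; ring
    _ ≤ |a| + |qa - a| := abs_add_le _ _
    _ ≤ |a| + ua * |a| := by linarith
    _ = (1 + ua) * |a| := by ring

/-- THE PRODUCT RULE of E-DEC (worst case of `qa·qb - a·b = a·β + α·b + α·β`): two relatively perturbed
factors give a product perturbed by at most `ε_Q = ua + ub + ua·ub` relative to `|a·b|`.
[cite: Higham2002ASNA, §3.1] -/
theorem abs_mul_sub_mul_le {a b qa qb ua ub : ℚ} (ha : |qa - a| ≤ ua * |a|)
    (hb : |qb - b| ≤ ub * |b|) : |qa * qb - a * b| ≤ (ua + ub + ua * ub) * |a * b| := by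
  have hid : qa * qb - a * b = a * (qb - b) + (qa - a) * b + (qa - a) * (qb - b) := by ring
  have h1 : |a * (qb - b)| ≤ |a| * (ub * |b|) := by
    rw [abs_mul]; exact mul_le_mul_of_nonneg_left hb (abs_nonneg a)
  have h2 : |(qa - a) * b| ≤ ua * |a| * |b| := by
    rw [abs_mul]; exact mul_le_mul_of_nonneg_right ha (abs_nonneg b)
  have h3 : |(qa - a) * (qb - b)| ≤ ua * |a| * (ub * |b|) := by
    rw [abs_mul]; exact mul_le_mul ha hb (abs_nonneg _) (le_trans (abs_nonneg _) ha)
  have t1 := abs_add_le (a * (qb - b) + (qa - a) * b) ((qa - a) * (qb - b))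
  have t2 := abs_add_le (a * (qb - b)) ((qa - a) * b)
  have e : (ua + ub + ua * ub) * |a * b|
      = |a| * (ub * |b|) + ua * |a| * |b| + ua * |a| * (ub * |b|) := by rw [abs_mul]; ring
  rw [hid, e]
  linarith

/-- Size of a product of perturbed factors: `|qa·qb| ≤ (1+ua)(1+ub)·|a·b|`. [cite: Higham2002ASNA, §3.1] -/
theorem abs_mul_le_of_rel {a b qa qb ua ub : ℚ} (ha : |qa - a| ≤ ua * |a|)
    (hb : |qb - b| ≤ ub * |b|) : |qa * qb| ≤ (1 + ua) * (1 + ub) * |a * b| := by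
  have h1 := abs_le_one_add_mul ha
  have h2 := abs_le_one_add_mul hb
  rw [abs_mul, abs_mul]
  calc |qa| * |qb| ≤ (1 + ua) * |a| * ((1 + ub) * |b|) :=
        mul_le_mul h1 h2 (abs_nonneg _) (le_trans (abs_nonneg _) h1)
    _ = (1 + ua) * (1 + ub) * (|a| * |b|) := by ring

/-! ## Summed over the inner dimension -/

section Sums

variable [Fintype ι] {a b qa qb : ι → ℚ} {ua ub : ℚ}

/-- Quantisation budget line, termwise summed: `∑ |qaₖ qbₖ - aₖ bₖ| ≤ ε_Q · ∑ |aₖ bₖ|`.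
[cite: Higham2002ASNA, §3.1] -/
theorem sum_abs_mul_sub_mul_le (ha : ∀ i, |qa i - a i| ≤ ua * |a i|)
    (hb : ∀ i, |qb i - b i| ≤ ub * |b i|) :
    ∑ i, |qa i * qb i - a i * b i| ≤ (ua + ub + ua * ub) * ∑ i, |a i * b i| := by
  rw [Finset.mul_sum]
  exact Finset.sum_le_sum fun i _ => abs_mul_sub_mul_le (ha i) (hb i)

/-- Quantisation budget line for the exact dot product of the quantised operands:
`|∑ qaₖ qbₖ - ∑ aₖ bₖ| ≤ ε_Q · ∑ |aₖ bₖ|` (functional F1 with exact accumulation and no output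
rounding). [cite: Higham2002ASNA, §3.1] -/
theorem abs_sum_mul_sub_sum_mul_le (ha : ∀ i, |qa i - a i| ≤ ua * |a i|)
    (hb : ∀ i, |qb i - b i| ≤ ub * |b i|) :
    |∑ i, qa i * qb i - ∑ i, a i * b i| ≤ (ua + ub + ua * ub) * ∑ i, |a i * b i| := by
  rw [← Finset.sum_sub_distrib]
  exact le_trans (Finset.abs_sum_le_sum_abs _ _) (sum_abs_mul_sub_mul_le ha hb)

/-- The accumulator's reference mass: `∑ |qaₖ qbₖ| ≤ (1+ua)(1+ub) · ∑ |aₖ bₖ| = (1 + ε_Q) · L`.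
[cite: Higham2002ASNA, §3.1] -/
theorem sum_abs_mul_le (ha : ∀ i, |qa i - a i| ≤ ua * |a i|)
    (hb : ∀ i, |qb i - b i| ≤ ub * |b i|) :
    ∑ i, |qa i * qb i| ≤ (1 + ua) * (1 + ub) * ∑ i, |a i * b i| := by
  rw [Finset.mul_sum]
  exact Finset.sum_le_sum fun i _ => abs_mul_le_of_rel (ha i) (hb i)

/-- The functional-F2 reference mass: `∑ |aₖ bₖ| ≤ K · A · B` when `|aₖ| ≤ A`, `|bₖ| ≤ B`. [folklore] -/
theorem sum_abs_mul_le_card_mul {A B : ℚ} (hA : ∀ i, |a i| ≤ A) (hB : ∀ i, |b i| ≤ B) :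
    ∑ i, |a i * b i| ≤ Fintype.card ι * (A * B) := by
  calc ∑ i, |a i * b i| ≤ ∑ _i : ι, A * B := Finset.sum_le_sum fun i _ => by
          rw [abs_mul]
          exact mul_le_mul (hA i) (hB i) (abs_nonneg _) (le_trans (abs_nonneg _) (hA i))
    _ = Fintype.card ι * (A * B) := by
          rw [Finset.sum_const, Finset.card_univ, nsmul_eq_mul]

end Sums

/-! ## E-DEC -/

/-- E-DEC, general finite inner dimension (THEOREM-SHAPES §4.1): operand quantisation `ua, ub`
(relative, per element), accumulation `γ` (relative to `∑ |qaₖ qbₖ|`), output / descaling `δ`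
(relative to `|acc|`) compose to the functional-F1 envelope
`|c - ∑ aₖ bₖ| ≤ (ε_Q + γ(1+ε_Q) + δ(1+ε_Q)(1+γ)) · ∑ |aₖ bₖ|`, `ε_Q = ua + ub + ua·ub`.
[cite: Higham2002ASNA, §3.1] -/
theorem eDec [Fintype ι] (a b qa qb : ι → ℚ) {ua ub γ δ acc c : ℚ} (hγ : 0 ≤ γ) (hδ : 0 ≤ δ)
    (hqa : ∀ i, |qa i - a i| ≤ ua * |a i|) (hqb : ∀ i, |qb i - b i| ≤ ub * |b i|)
    (hacc : |acc - ∑ i, qa i * qb i| ≤ γ * ∑ i, |qa i * qb i|) (hc : |c - acc| ≤ δ * |acc|) :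
    |c - ∑ i, a i * b i|
      ≤ ((ua + ub + ua * ub) + γ * (1 + (ua + ub + ua * ub))
          + δ * (1 + (ua + ub + ua * ub)) * (1 + γ)) * ∑ i, |a i * b i| := by
  have hL0 : 0 ≤ ∑ i, |a i * b i| := Finset.sum_nonneg fun i _ => abs_nonneg _
  have hring : (1 + ua) * (1 + ub) = 1 + (ua + ub + ua * ub) := by ring
  have h1 : |∑ i, qa i * qb i - ∑ i, a i * b i| ≤ (ua + ub + ua * ub) * ∑ i, |a i * b i| :=
    abs_sum_mul_sub_sum_mul_le hqa hqb
  have h2 : ∑ i, |qa i * qb i| ≤ (1 + (ua + ub + ua * ub)) * ∑ i, |a i * b i| := by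
    rw [← hring]; exact sum_abs_mul_le hqa hqb
  have h3 : |acc - ∑ i, qa i * qb i| ≤ γ * ((1 + (ua + ub + ua * ub)) * ∑ i, |a i * b i|) :=
    le_trans hacc (mul_le_mul_of_nonneg_left h2 hγ)
  have h4 : |∑ i, qa i * qb i| ≤ (1 + (ua + ub + ua * ub)) * ∑ i, |a i * b i| :=
    le_trans (Finset.abs_sum_le_sum_abs _ _) h2
  have h5 : |acc| ≤ (1 + γ) * ((1 + (ua + ub + ua * ub)) * ∑ i, |a i * b i|) := by
    have ht := abs_add_le (acc - ∑ i, qa i * qb i) (∑ i, qa i * qb i)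
    rw [sub_add_cancel] at ht
    linarith
  have h6 : |c - acc| ≤ δ * ((1 + γ) * ((1 + (ua + ub + ua * ub)) * ∑ i, |a i * b i|)) :=
    le_trans hc (mul_le_mul_of_nonneg_left h5 hδ)
  have htri : |c - ∑ i, a i * b i|
      ≤ |c - acc| + |acc - ∑ i, qa i * qb i| + |∑ i, qa i * qb i - ∑ i, a i * b i| := by
    have e : c - ∑ i, a i * b i
        = (c - acc) + (acc - ∑ i, qa i * qb i) + (∑ i, qa i * qb i - ∑ i, a i * b i) := by ring
    have t1 := abs_add_le ((c - acc) + (acc - ∑ i, qa i * qb i)) (∑ i, qa i * qb i - ∑ i, a i * b i)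
    have t2 := abs_add_le (c - acc) (acc - ∑ i, qa i * qb i)
    rw [e]
    linarith
  calc |c - ∑ i, a i * b i|
      ≤ |c - acc| + |acc - ∑ i, qa i * qb i| + |∑ i, qa i * qb i - ∑ i, a i * b i| := htri
    _ ≤ δ * ((1 + γ) * ((1 + (ua + ub + ua * ub)) * ∑ i, |a i * b i|))
          + γ * ((1 + (ua + ub + ua * ub)) * ∑ i, |a i * b i|)
          + (ua + ub + ua * ub) * ∑ i, |a i * b i| := add_le_add (add_le_add h6 h3) h1
    _ = ((ua + ub + ua * ub) + γ * (1 + (ua + ub + ua * ub))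
          + δ * (1 + (ua + ub + ua * ub)) * (1 + γ)) * ∑ i, |a i * b i| := by ring

/-- L1 `EDecF1` of the cell's THEOREM-SHAPES §7, VERBATIM (inner dimension `Fin K`; the sign
hypotheses on `ua`, `ub` are part of the recorded candidate and not needed by the proof).
[cite: Higham2002ASNA, §3.1] -/
theorem eDecF1 :
    ∀ (K : ℕ) (a b qa qb : Fin K → ℚ) (ua ub γ δ acc c : ℚ),
      0 ≤ ua → 0 ≤ ub → 0 ≤ γ → 0 ≤ δ →
      (∀ k, |qa k - a k| ≤ ua * |a k|) → (∀ k, |qb k - b k| ≤ ub * |b k|) →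
      |acc - ∑ k, qa k * qb k| ≤ γ * ∑ k, |qa k * qb k| → |c - acc| ≤ δ * |acc| →
      |c - ∑ k, a k * b k|
        ≤ ((ua + ub + ua * ub) + γ * (1 + (ua + ub + ua * ub))
            + δ * (1 + (ua + ub + ua * ub)) * (1 + γ)) * ∑ k, |a k * b k| := by
  intro K a b qa qb ua ub γ δ acc c _ _ hγ hδ hqa hqb hacc hc
  exact eDec a b qa qb hγ hδ hqa hqb hacc hc

/-- E-DEC with ONE quantised operand (`qb = b`, e.g. a pre-quantised weight matrix held exactly in
the analysis): the constant is `ua + γ(1+ua) + δ(1+ua)(1+γ)`. [cite: Higham2002ASNA, §3.1] -/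
theorem eDec_oneOperand [Fintype ι] (a b qa : ι → ℚ) {ua γ δ acc c : ℚ} (hγ : 0 ≤ γ) (hδ : 0 ≤ δ)
    (hqa : ∀ i, |qa i - a i| ≤ ua * |a i|)
    (hacc : |acc - ∑ i, qa i * b i| ≤ γ * ∑ i, |qa i * b i|) (hc : |c - acc| ≤ δ * |acc|) :
    |c - ∑ i, a i * b i| ≤ (ua + γ * (1 + ua) + δ * (1 + ua) * (1 + γ)) * ∑ i, |a i * b i| := by
  have hqb : ∀ i, |b i - b i| ≤ (0 : ℚ) * |b i| := fun i => by simp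
  refine le_trans (eDec a b qa b hγ hδ hqa hqb hacc hc) (le_of_eq ?_)
  ring

/-- E-DEC in the absolute functional F2 (`|error| / (K · ‖a‖_∞ · ‖b‖_∞)`): under `|aₖ| ≤ A`,
`|bₖ| ≤ B` the F1 envelope times `∑ |aₖ bₖ| ≤ K·A·B` (here the constants must be nonnegative to
scale the bound). [cite: Higham2002ASNA, §3.1] -/
theorem eDec_abs [Fintype ι] (a b qa qb : ι → ℚ) {ua ub γ δ acc c A B : ℚ} (hua : 0 ≤ ua)
    (hub : 0 ≤ ub) (hγ : 0 ≤ γ) (hδ : 0 ≤ δ)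
    (hqa : ∀ i, |qa i - a i| ≤ ua * |a i|) (hqb : ∀ i, |qb i - b i| ≤ ub * |b i|)
    (hacc : |acc - ∑ i, qa i * qb i| ≤ γ * ∑ i, |qa i * qb i|) (hc : |c - acc| ≤ δ * |acc|)
    (hA : ∀ i, |a i| ≤ A) (hB : ∀ i, |b i| ≤ B) :
    |c - ∑ i, a i * b i|
      ≤ ((ua + ub + ua * ub) + γ * (1 + (ua + ub + ua * ub))
          + δ * (1 + (ua + ub + ua * ub)) * (1 + γ)) * (Fintype.card ι * (A * B)) := by
  have hcoef : 0 ≤ (ua + ub + ua * ub) + γ * (1 + (ua + ub + ua * ub))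
      + δ * (1 + (ua + ub + ua * ub)) * (1 + γ) := by positivity
  exact le_trans (eDec a b qa qb hγ hδ hqa hqb hacc hc)
    (mul_le_mul_of_nonneg_left (sum_abs_mul_le_card_mul hA hB) hcoef)

/-- The quantisation line ALONE in functional F2: `|∑ qaₖ qbₖ - ∑ aₖ bₖ| ≤ ε_Q · K · A · B`.
[cite: Higham2002ASNA, §3.1] -/
theorem abs_sum_mul_sub_sum_mul_le_abs [Fintype ι] (a b qa qb : ι → ℚ) {ua ub A B : ℚ}
    (hua : 0 ≤ ua) (hub : 0 ≤ ub)
    (hqa : ∀ i, |qa i - a i| ≤ ua * |a i|) (hqb : ∀ i, |qb i - b i| ≤ ub * |b i|)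
    (hA : ∀ i, |a i| ≤ A) (hB : ∀ i, |b i| ≤ B) :
    |∑ i, qa i * qb i - ∑ i, a i * b i| ≤ (ua + ub + ua * ub) * (Fintype.card ι * (A * B)) := by
  have hcoef : 0 ≤ ua + ub + ua * ub := by positivity
  exact le_trans (abs_sum_mul_sub_sum_mul_le hqa hqb)
    (mul_le_mul_of_nonneg_left (sum_abs_mul_le_card_mul hA hB) hcoef)

/-! ## Blocked inner dimension (MX: `K = B · k`, one scale per block and operand) -/

/-- E-DEC over a BLOCKED inner dimension `Fin B × Fin k` written with double sums, the shape in
which the MX instances are discharged (one shared scale per block `j` and operand): the same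
constant, with `L = ∑ⱼ ∑ᵢ |aⱼᵢ bⱼᵢ|`. [cite: RouhaniEtAl2023MX, §2] -/
theorem eDec_blocked {B k : ℕ} (a b qa qb : Fin B → Fin k → ℚ) {ua ub γ δ acc c : ℚ}
    (hγ : 0 ≤ γ) (hδ : 0 ≤ δ)
    (hqa : ∀ j i, |qa j i - a j i| ≤ ua * |a j i|) (hqb : ∀ j i, |qb j i - b j i| ≤ ub * |b j i|)
    (hacc : |acc - ∑ j, ∑ i, qa j i * qb j i| ≤ γ * ∑ j, ∑ i, |qa j i * qb j i|)
    (hc : |c - acc| ≤ δ * |acc|) :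
    |c - ∑ j, ∑ i, a j i * b j i|
      ≤ ((ua + ub + ua * ub) + γ * (1 + (ua + ub + ua * ub))
          + δ * (1 + (ua + ub + ua * ub)) * (1 + γ)) * ∑ j, ∑ i, |a j i * b j i| := by
  have key := eDec (ι := Fin B × Fin k) (fun p => a p.1 p.2) (fun p => b p.1 p.2)
    (fun p => qa p.1 p.2) (fun p => qb p.1 p.2) (ua := ua) (ub := ub) (γ := γ) (δ := δ)
    (acc := acc) (c := c) hγ hδ (fun p => hqa p.1 p.2) (fun p => hqb p.1 p.2)
  simp only [Fintype.sum_prod_type] at key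
  exact key hacc hc

end Summit.Ventures.CertifiedArithmetic.LowPrec.GemmEnvelope
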